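/-
Origin: expansion seat `planner-pub-hodgecm-pv10-g4-0`, handover #6 2026-08-18T11:22:31Z (`HOME/pub-hodgecm-pv10-g4/lean/Pv10g4/LevelLattice.lean`, md5 01378663, 530 lines);
landed by the gen-8 packager in gate run 29 as `HodgeCM/PerL34/LevelLattice.lean` (import ^import Pv[0-9]+g[0-9]+\.→import HodgeCM.PerL34. ×1; stripped 4 #print/#check/#eval lines).
-/
/-
Origin: pub-hodgecm cell, seat pv10-g4 (unit `pub-hodgecm-pv10-g4`, DAG-node prover #10, gen 4), 2026-08-18.
WIP module `Pv10g4.LevelLattice`; intended landing place `HodgeCM/PerL34/LevelLattice.lean`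
(import rewrite on landing: `import Pv10g4.TorsionFreeAction` ↦ `import HodgeCM.PerL34.TorsionFreeAction`).
-/
import Summits.HodgeConjecture.HodgeCM.PerL34.TorsionFreeAction
import Literature.NumberTheory.Automorphic.GLnAdelicStructureProofs

/-!
# Every `Level` of a hermitian 3-space is a uniform, torsion-free lattice in `G_U(ℝ)` (PerL v5 ll. 66–73, KERNEL)

`HodgeCM.Level V` (the index set of the universe of surfaces `P_Γ`, `HodgeCM/CM/Basic.lean`) is a torsion-free
CONGRUENCE subgroup `Γ ≤ U(V₃,h)(L₀) ≤ GL₃(L)` in the RATIONAL sense of the vendored `IsCongruenceSubgroup`: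
`Γ(n) ≤ Γ ≤ U(H)(L₀)` with finite index for some `n ≥ 1`, where `Γ(n) = principalCongruenceSubgroup σ H n` is cut
out by the integral congruences `g ≡ 1`, `g⁻¹ ≡ 1 (mod n)` (`IsCongruentOneMod`).  The Godement-lane files
`CongruenceLattice` / `TorsionFreeAction` (this seat, rows #4/#5) treat ADELIC levels `Γ_H(K_f) = pr_∞(U(H)(L₀) ∩
(U(H)_∞ × K_f))` for compact open `K_f ≤ U(H)(𝔸_{L₀,f})`.  This file is the bridge between the two, entirely in
the kernel:

* §0 two pieces of general topology: a finite-index overgroup of a discrete subgroup of a Hausdorff group is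
  discrete (`discreteTopology_of_finiteIndex`), and an overgroup of a cocompact subgroup is cocompact
  (`compactSpace_quotient_of_le`); closedness of unitary groups (`isClosed_unitaryGroup`).
* §1 the GL-level principal congruence subgroup `finLevel L m n ≤ GL_m(𝔸_{L,f})`: the `k ∈ GL_m(𝒪̂_L)` with
  `n⁻¹(k − 1), n⁻¹(k⁻¹ − 1) ∈ M_m(𝒪̂_L)` (`n⁻¹ ∈ L ⊂ 𝔸_{L,f}`; `n` is a unit of `𝔸_{L,f}`), as the unit group of
  an explicit submonoid of `M_m(𝔸_{L,f})`; it is OPEN and COMPACT (from the cone's `isOpen_integralFiniteAdeles`,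
  `isCompact_integralFiniteAdeles`, Mathlib `Submonoid.isOpen_units` / `Submonoid.units_isCompact`), and so is
  its trace `levelUfin L H n ≤ Ufin L H` (`Ufin` being closed).
* §2 RATIONAL POINTS: for `0 < n` and `g ∈ GL_m(L)`, the finite-adelic image `toFinGL g` lies in `finLevel n` iff
  `g ≡ 1 ∧ g⁻¹ ≡ 1 (mod n)` integrally (`toFinGL_mem_finLevel_iff`; local-global integrality = the cone's
  `exists_algebraMap_eq_of_forall_coe_mem`).  Consequently the archimedean image
  `archLattice L H Γ(n)` of the vendored `Γ(n)` IS the adelic congruence lattice: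
  **`congruenceLattice L H (levelUfin L H n) = archLattice L H (principalCongruenceSubgroup (conjRingHomK L) H n)`**.
* §3 HEADLINES, for every `V : HermSpace3 L ι₁` and EVERY `Λ : Level V`:
  `Γ_∞ := archLattice L V.Hm Λ.Γ ≤ Uinf L V.Hm = G_U(ℝ)` is isomorphic to `Λ.Γ` (`Level.archLatticeEquiv`),
  DISCRETE (`Level.discreteTopology_archLattice`), COCOMPACT when `[L:ℚ] ≠ 2`
  (`Level.compactSpace_quotient_archLattice`, Landherr anisotropy), TORSION-FREE (`Level.torsionFree_archLattice`),
  hence acts FREELY on `G_U(ℝ)/C` for every compact subgroup `C` (`Level.stabilizer_archLattice_eq_bot`, row #5):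
  PerL v5 §1.2 ll. 66–73 "smooth projective surface `P_Γ = Γ\𝔹²`" at group level for every member of the
  universe's index set, not only for adelically presented levels.

Pure kernel mathematics over Mathlib + the package; nothing cited as hypothesis, nothing posited; closures are the
standard trio.
-/

set_option autoImplicit false

noncomputable section

open scoped Pointwise MatrixGroups RestrictedProduct Matrix
open NumberField IsDedekindDomain Topology
open Literature.AlgebraicGeometry.ShimuraVarieties
open HodgeCM.Adelic HodgeCM.PerL34.AdelicUnitaryFactorisation

namespace HodgeCM.PerL34.Godement

/-! ## §0 General lemmas -/

section General

variable {A : Type*} [Group A] [TopologicalSpace A] [IsTopologicalGroup A]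

/-- An overgroup of a cocompact subgroup is cocompact. -/
theorem compactSpace_quotient_of_le {Γ Δ : Subgroup A} (h : Γ ≤ Δ) [CompactSpace (A ⧸ Γ)] :
    CompactSpace (A ⧸ Δ) := by
  let f : A ⧸ Γ → A ⧸ Δ := Subgroup.quotientMapOfLE h
  have hf : Continuous f := by
    rw [(QuotientGroup.isOpenQuotientMap_mk (N := Γ)).isQuotientMap.continuous_iff]
    exact QuotientGroup.continuous_mk
  have hsurj : Function.Surjective f := by
    rintro ⟨a⟩
    exact ⟨(a : A ⧸ Γ), rfl⟩
  exact ⟨by rw [← hsurj.range_eq, ← Set.image_univ]; exact isCompact_univ.image hf⟩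

variable [T2Space A]

/-- **A subgroup `Δ` of a Hausdorff group meeting a discrete subgroup `Γ` in a finite-index subgroup `Γ ⊓ Δ ≤ Δ`
is discrete** (in particular a finite-index overgroup of a discrete subgroup is discrete). -/
theorem discreteTopology_of_finiteIndex (Γ Δ : Subgroup A) [DiscreteTopology Γ]
    [hfi : (Γ.subgroupOf Δ).FiniteIndex] : DiscreteTopology Δ := by
  -- `Γ' := Γ ∩ Δ ≤ Δ` is discrete, hence closed in `Δ`
  set Γ' : Subgroup Δ := Γ.subgroupOf Δ with hΓ'
  haveI hdΓ' : DiscreteTopology Γ' :=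
    DiscreteTopology.of_continuous_injective (f := fun x : Γ' => (⟨(x : Δ), x.2⟩ : Γ))
      (by fun_prop) (fun x y hxy => by
        have h := congrArg (fun z : Γ => (z : A)) hxy
        exact Subtype.ext (Subtype.ext h))
  have hcl : IsClosed (Γ' : Set Δ) := Subgroup.isClosed_of_discrete
  -- the union of the non-identity cosets is closed, so the identity coset `Γ'` is open in `Δ`
  haveI : Finite (Δ ⧸ Γ') := Subgroup.finite_quotient_of_finiteIndex
  have hcos : ∀ q : Δ ⧸ Γ', IsClosed {d : Δ | (d : Δ ⧸ Γ') = q} := by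
    rintro ⟨d₀⟩
    have hset : {d : Δ | (d : Δ ⧸ Γ') = Quot.mk _ d₀} = d₀ • (Γ' : Set Δ) := by
      ext d
      simp only [Set.mem_setOf_eq]
      change (d : Δ ⧸ Γ') = (d₀ : Δ ⧸ Γ') ↔ _
      rw [eq_comm, QuotientGroup.eq, mem_leftCoset_iff]
      rfl
    rw [hset]
    exact hcl.smul d₀
  have hmem : ∀ d : Δ, (d : Δ ⧸ Γ') = ((1 : Δ) : Δ ⧸ Γ') ↔ d ∈ Γ' := fun d => by
    rw [eq_comm, QuotientGroup.eq, inv_one, one_mul]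
  have hopenΓ' : IsOpen (Γ' : Set Δ) := by
    have hcompl : (Γ' : Set Δ)ᶜ = ⋃ q ∈ {q : Δ ⧸ Γ' | q ≠ ((1 : Δ) : Δ ⧸ Γ')}, {d : Δ | (d : Δ ⧸ Γ') = q} := by
      ext d
      simp only [Set.mem_compl_iff, SetLike.mem_coe, Set.mem_iUnion, Set.mem_setOf_eq, exists_prop,
        exists_eq_right', ne_eq, hmem]
    have hc : IsClosed (Γ' : Set Δ)ᶜ := by
      rw [hcompl]
      exact (Set.toFinite _).isClosed_biUnion fun q _ => hcos q
    simpa using hc.isOpen_compl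
  -- `{1}` is open in the discrete `Γ'`, which is open in `Δ`
  rw [discreteTopology_iff_isOpen_singleton_one]
  obtain ⟨W, hW, hW1⟩ := isOpen_induced_iff.mp (isOpen_discrete ({1} : Set Γ'))
  have h1 : ({1} : Set Δ) = W ∩ (Γ' : Set Δ) := by
    ext d
    constructor
    · rintro rfl
      refine ⟨?_, one_mem _⟩
      have : (1 : Γ') ∈ Subtype.val ⁻¹' W := by rw [hW1]; rfl
      exact this
    · rintro ⟨hdW, hdΓ⟩
      have : (⟨d, hdΓ⟩ : Γ') ∈ Subtype.val ⁻¹' W := hdW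
      rw [hW1] at this
      exact congrArg Subtype.val this
  rw [h1]
  exact hW.inter hopenΓ'

end General

section Unitary

variable {R : Type*} [CommRing R] [TopologicalSpace R] [IsTopologicalRing R] [T2Space R]
  {n : Type*} [Fintype n] [DecidableEq n]

/-- A unitary group `{g | (σ g)ᵀ H g = H} ≤ GL_n(R)` for a continuous `σ` is closed. -/
theorem isClosed_unitaryGroup {σ : R →+* R} (hσ : Continuous σ) (H : Matrix n n R) :
    IsClosed (unitaryGroup σ H : Set (GL n R)) := by
  have h1 : Continuous fun g : GL n R => (g : Matrix n n R) := Units.continuous_val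
  have hc : Continuous fun g : GL n R => ((g : Matrix n n R).map σ).transpose * H * (g : Matrix n n R) :=
    ((h1.matrix_map hσ).matrix_transpose.mul continuous_const).mul h1
  exact isClosed_eq hc continuous_const

end Unitary

/-! ## §1 The principal congruence subgroups `K(n) ≤ GL_m(𝔸_{L,f})` and `K_H(n) ≤ U(H)(𝔸_{L₀,f})` -/

section FinLevel

variable (L : CMField) (m : ℕ)

local notation "𝔸f" => FiniteAdeleRing (𝓞 L) L

/-- `n⁻¹ ∈ L ⊂ 𝔸_{L,f}` (junk value `0` for `n = 0`). -/
def levelScalar (n : ℕ) : 𝔸f := algebraMap (L : Type) 𝔸f ((n : L)⁻¹)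

/-- The submonoid `{M ∈ M_m(𝒪̂_L) | n⁻¹(M − 1) ∈ M_m(𝒪̂_L)}` of `M_m(𝔸_{L,f})`. -/
def finLevelSubmonoid (n : ℕ) : Submonoid (Matrix (Fin m) (Fin m) 𝔸f) where
  carrier := {M | (∀ i j, M i j ∈ Literature.NumberTheory.Automorphic.integralFiniteAdeles L) ∧
    ∀ i j, levelScalar L n * (M - 1) i j ∈ Literature.NumberTheory.Automorphic.integralFiniteAdeles L}
  one_mem' := by
    refine ⟨fun i j => ?_, fun i j => by simp [sub_self]⟩
    rw [Matrix.one_apply]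
    split_ifs
    · exact one_mem _
    · exact zero_mem _
  mul_mem' := by
    rintro M N ⟨hM₁, hM₂⟩ ⟨hN₁, hN₂⟩
    refine ⟨fun i j => ?_, fun i j => ?_⟩
    · rw [Matrix.mul_apply]
      exact sum_mem fun k _ => mul_mem (hM₁ i k) (hN₁ k j)
    · have hMN : M * N - 1 = (M - 1) * N + (N - 1) := by noncomm_ring
      rw [hMN, Matrix.add_apply, Matrix.mul_apply, mul_add, Finset.mul_sum]
      refine add_mem (sum_mem fun k _ => ?_) (hN₂ i j)
      rw [← mul_assoc]
      exact mul_mem (hM₂ i k) (hN₁ k j)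

variable {L} in
/-- (Ported verbatim from the HodgeCMPerL package; no docstring in the source.) -/
theorem mem_finLevelSubmonoid_iff {n : ℕ} {M : Matrix (Fin m) (Fin m) 𝔸f} :
    M ∈ finLevelSubmonoid L m n ↔
      (∀ i j, M i j ∈ Literature.NumberTheory.Automorphic.integralFiniteAdeles L) ∧
        ∀ i j, levelScalar L n * (M - 1) i j ∈ Literature.NumberTheory.Automorphic.integralFiniteAdeles L :=
  Iff.rfl

/-- (Ported verbatim from the HodgeCMPerL package; no docstring in the source.) -/
theorem coe_finLevelSubmonoid (n : ℕ) :
    (finLevelSubmonoid L m n : Set (Matrix (Fin m) (Fin m) 𝔸f)) =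
      (Literature.NumberTheory.Automorphic.integralFiniteAdeles L : Set 𝔸f).matrix ∩
        ⋂ i, ⋂ j, (fun M : Matrix (Fin m) (Fin m) 𝔸f => levelScalar L n * (M - 1) i j) ⁻¹'
          (Literature.NumberTheory.Automorphic.integralFiniteAdeles L : Set 𝔸f) := by
  ext M
  simp [mem_finLevelSubmonoid_iff, Set.mem_matrix]

/-- (Ported verbatim from the HodgeCMPerL package; no docstring in the source.) -/
theorem isOpen_finLevelSubmonoid (n : ℕ) :
    IsOpen (finLevelSubmonoid L m n : Set (Matrix (Fin m) (Fin m) 𝔸f)) := by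
  rw [coe_finLevelSubmonoid]
  refine (Literature.NumberTheory.Automorphic.isOpen_integralFiniteAdeles L).matrix.inter
    (isOpen_iInter_of_finite fun i => isOpen_iInter_of_finite fun j => ?_)
  exact (Literature.NumberTheory.Automorphic.isOpen_integralFiniteAdeles L).preimage
    (continuous_const.mul ((continuous_id.sub continuous_const).matrix_elem i j))

/-- (Ported verbatim from the HodgeCMPerL package; no docstring in the source.) -/
theorem isCompact_finLevelSubmonoid (n : ℕ) :
    IsCompact (finLevelSubmonoid L m n : Set (Matrix (Fin m) (Fin m) 𝔸f)) := by
  haveI : T2Space 𝔸f := inferInstanceAs <| T2Space <|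
    Πʳ v : HeightOneSpectrum (𝓞 L), [v.adicCompletion L, v.adicCompletionIntegers L]
  rw [coe_finLevelSubmonoid]
  refine (Literature.NumberTheory.Automorphic.isCompact_integralFiniteAdeles L).matrix.inter_right
    (isClosed_iInter fun i => isClosed_iInter fun j => ?_)
  exact (Literature.NumberTheory.Automorphic.isCompact_integralFiniteAdeles L).isClosed.preimage
    (continuous_const.mul ((continuous_id.sub continuous_const).matrix_elem i j))

/-- **The principal congruence subgroup `K(n) ≤ GL_m(𝔸_{L,f})`**: the `k ∈ GL_m(𝒪̂_L)` with
`n⁻¹(k − 1), n⁻¹(k⁻¹ − 1) ∈ M_m(𝒪̂_L)` (for `n = 0` the junk value is `GL_m(𝒪̂_L)`). -/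
def finLevel (n : ℕ) : Subgroup (GL (Fin m) 𝔸f) := (finLevelSubmonoid L m n).units

variable {L} in
/-- (Ported verbatim from the HodgeCMPerL package; no docstring in the source.) -/
theorem mem_finLevel_iff {n : ℕ} {k : GL (Fin m) 𝔸f} :
    k ∈ finLevel L m n ↔ (k : Matrix (Fin m) (Fin m) 𝔸f) ∈ finLevelSubmonoid L m n ∧
      ((k⁻¹ : GL (Fin m) 𝔸f) : Matrix (Fin m) (Fin m) 𝔸f) ∈ finLevelSubmonoid L m n :=
  Iff.rfl

/-- `K(n) ≤ GL_m(𝒪̂_L)`. -/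
theorem finLevel_le (n : ℕ) :
    finLevel L m n ≤ Literature.NumberTheory.Automorphic.glFiniteIntegralLevel m L := fun _ hk =>
  Literature.NumberTheory.Automorphic.mem_glFiniteIntegralLevel_iff.mpr ⟨hk.1.1, hk.2.1⟩

/-- `K(n)` is open in `GL_m(𝔸_{L,f})`. -/
theorem isOpen_finLevel (n : ℕ) : IsOpen (finLevel L m n : Set (GL (Fin m) 𝔸f)) :=
  Submonoid.isOpen_units (isOpen_finLevelSubmonoid L m n)

/-- `K(n)` is compact. -/
theorem isCompact_finLevel (n : ℕ) : IsCompact (finLevel L m n : Set (GL (Fin m) 𝔸f)) := by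
  haveI : T2Space 𝔸f := inferInstanceAs <| T2Space <|
    Πʳ v : HeightOneSpectrum (𝓞 L), [v.adicCompletion L, v.adicCompletionIntegers L]
  exact Submonoid.units_isCompact (isCompact_finLevelSubmonoid L m n)

variable {m} (H : Matrix (Fin m) (Fin m) L)

/-- `U(H)(𝔸_{L₀,f})` is closed in `GL_m(𝔸_{L,f})`. -/
theorem isClosed_Ufin : IsClosed (Ufin L H : Set (GL (Fin m) 𝔸f)) := by
  haveI : T2Space 𝔸f := inferInstanceAs <| T2Space <|
    Πʳ v : HeightOneSpectrum (𝓞 L), [v.adicCompletion L, v.adicCompletionIntegers L]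
  exact isClosed_unitaryGroup (continuous_finConj L) _

/-- **The principal congruence level `K_H(n) := U(H)(𝔸_{L₀,f}) ∩ K(n) ≤ U(H)(𝔸_{L₀,f})`.** -/
def levelUfin (n : ℕ) : Subgroup (Ufin L H) := (finLevel L m n).subgroupOf (Ufin L H)

variable {L H} in
/-- (Ported verbatim from the HodgeCMPerL package; no docstring in the source.) -/
theorem mem_levelUfin_iff {n : ℕ} {k : Ufin L H} :
    k ∈ levelUfin L H n ↔ (k : GL (Fin m) 𝔸f) ∈ finLevel L m n :=
  Subgroup.mem_subgroupOf

/-- `K_H(n)` is open in `U(H)(𝔸_{L₀,f})`. -/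
theorem isOpen_levelUfin (n : ℕ) : IsOpen (levelUfin L H n : Set (Ufin L H)) :=
  (isOpen_finLevel L m n).preimage continuous_subtype_val

/-- `K_H(n)` is compact. -/
theorem isCompact_levelUfin (n : ℕ) : IsCompact (levelUfin L H n : Set (Ufin L H)) :=
  (isClosed_Ufin L H).isClosedEmbedding_subtypeVal.isCompact_preimage (isCompact_finLevel L m n)

end FinLevel

/-! ## §2 Rational points: `GL_m(L) ∩ K(n) = Γ(n)` -/

section Rational

variable (L : CMField) {m : ℕ}

local notation "𝔸f" => FiniteAdeleRing (𝓞 L) L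

/-- The diagonal embedding `GL_m(L) → GL_m(𝔸_{L,f})`. -/
def toFinGL : GL (Fin m) L →* GL (Fin m) 𝔸f :=
  Units.map (RingHom.mapMatrix (algebraMap (L : Type) 𝔸f)).toMonoidHom

/-- The diagonal embedding `GL_m(L) → GL_m(L_∞)`, `L_∞ = L ⊗_ℚ ℝ`. -/
def toInfGL : GL (Fin m) L →* GL (Fin m) (InfiniteAdeleRing L) :=
  Units.map (RingHom.mapMatrix (algebraMap (L : Type) (InfiniteAdeleRing L))).toMonoidHom

/-- (Ported verbatim from the HodgeCMPerL package; no docstring in the source.) -/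
@[simp] theorem val_toFinGL (g : GL (Fin m) L) :
    ((toFinGL L g : GL (Fin m) 𝔸f) : Matrix (Fin m) (Fin m) 𝔸f) =
      (g : Matrix (Fin m) (Fin m) L).map (algebraMap (L : Type) 𝔸f) := rfl

/-- (Ported verbatim from the HodgeCMPerL package; no docstring in the source.) -/
@[simp] theorem val_toInfGL (g : GL (Fin m) L) :
    ((toInfGL L g : GL (Fin m) (InfiniteAdeleRing L)) : Matrix (Fin m) (Fin m) (InfiniteAdeleRing L)) =
      (g : Matrix (Fin m) (Fin m) L).map (algebraMap (L : Type) (InfiniteAdeleRing L)) := rfl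

/-- (Ported verbatim from the HodgeCMPerL package; no docstring in the source.) -/
theorem toInfGL_injective : Function.Injective (toInfGL L (m := m)) := by
  intro g h hgh
  have := congrArg
    (fun u : GL (Fin m) (InfiniteAdeleRing L) => (u : Matrix (Fin m) (Fin m) (InfiniteAdeleRing L))) hgh
  simp only [val_toInfGL] at this
  exact Units.ext (Matrix.map_injective (algebraMap (L : Type) (InfiniteAdeleRing L)).injective this)

variable (H : Matrix (Fin m) (Fin m) L)

/-- The archimedean component of a rational point `g ∈ U(H)(L₀)` is `toInfGL g`. -/
theorem coe_splitEquiv_fst_toAdeleGL (g : GL (Fin m) L) (hg : toAdeleGL L g ∈ adelicUnitaryGroup L H) :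
    ((splitEquiv L H ⟨toAdeleGL L g, hg⟩).1 : GL (Fin m) (InfiniteAdeleRing L)) = toInfGL L g := by
  apply Units.ext
  ext i j
  rw [val_splitEquiv_fst, val_toInfGL]
  rfl

/-- The finite-adelic component of a rational point `g ∈ U(H)(L₀)` is `toFinGL g`. -/
theorem coe_splitEquiv_snd_toAdeleGL (g : GL (Fin m) L) (hg : toAdeleGL L g ∈ adelicUnitaryGroup L H) :
    ((splitEquiv L H ⟨toAdeleGL L g, hg⟩).2 : GL (Fin m) 𝔸f) = toFinGL L g := by
  apply Units.ext
  ext i j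
  rw [val_splitEquiv_snd, val_toFinGL]
  rfl

variable {H} in
/-- (Ported verbatim from the HodgeCMPerL package; no docstring in the source.) -/
theorem toInfGL_mem_Uinf {g : GL (Fin m) L} (hg : g ∈ unitaryGroup (conjRingHomK L) H) :
    toInfGL L g ∈ Uinf L H := by
  rw [← coe_splitEquiv_fst_toAdeleGL L H g (toAdeleGL_mem L H hg)]
  exact SetLike.coe_mem _

variable {H} in
/-- (Ported verbatim from the HodgeCMPerL package; no docstring in the source.) -/
theorem toFinGL_mem_Ufin {g : GL (Fin m) L} (hg : g ∈ unitaryGroup (conjRingHomK L) H) :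
    toFinGL L g ∈ Ufin L H := by
  rw [← coe_splitEquiv_snd_toAdeleGL L H g (toAdeleGL_mem L H hg)]
  exact SetLike.coe_mem _

variable {L} in
/-- Local-global integrality: `x ∈ L` lies in `𝒪̂_L` (at every finite place) iff `x ∈ 𝓞_L`. -/
theorem algebraMap_mem_integralFiniteAdeles_iff (x : L) :
    algebraMap (L : Type) 𝔸f x ∈ Literature.NumberTheory.Automorphic.integralFiniteAdeles L ↔
      ∃ r : 𝓞 L, algebraMap (𝓞 L) L r = x := by
  rw [Literature.NumberTheory.Automorphic.mem_integralFiniteAdeles_iff]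
  constructor
  · intro h
    exact Literature.NumberTheory.Automorphic.exists_algebraMap_eq_of_forall_coe_mem (𝓞 L) L x
      fun v => by simpa only [FiniteAdeleRing.algebraMap_apply] using h v
  · rintro ⟨r, rfl⟩ v
    rw [FiniteAdeleRing.algebraMap_apply]
    exact (HeightOneSpectrum.mem_adicCompletionIntegers (𝓞 L) L v).2
      (by rw [HeightOneSpectrum.valuedAdicCompletion_eq_valuation' v]; exact v.valuation_le_one r)

variable {L} in
/-- `M ≡ 1 (mod n)` integrally iff every entry of `n⁻¹(M − 1)` is in `𝓞_L` (`0 < n`). -/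
theorem isCongruentOneMod_iff {n : ℕ} (hn : 0 < n) (M : Matrix (Fin m) (Fin m) L) :
    IsCongruentOneMod n M ↔ ∀ i j, ∃ r : 𝓞 L, algebraMap (𝓞 L) L r = (n : L)⁻¹ * (M - 1) i j := by
  have hn' : (n : L) ≠ 0 := Nat.cast_ne_zero.mpr hn.ne'
  constructor
  · rintro ⟨A, hA⟩ i j
    refine ⟨A i j, ?_⟩
    rw [hA, add_sub_cancel_left, Matrix.smul_apply, Matrix.map_apply, nsmul_eq_mul, ← mul_assoc,
      inv_mul_cancel₀ hn', one_mul]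
  · intro h
    choose r hr using h
    refine ⟨Matrix.of fun i j => r i j, ?_⟩
    ext i j
    rw [Matrix.add_apply, Matrix.smul_apply, Matrix.map_apply, Matrix.of_apply, hr, nsmul_eq_mul,
      ← mul_assoc, mul_inv_cancel₀ hn', one_mul, Matrix.sub_apply, add_sub_cancel]

variable {L} in
/-- A rational matrix lies in the level-`n` submonoid iff it is `≡ 1 (mod n)` integrally (`0 < n`). -/
theorem map_mem_finLevelSubmonoid_iff {n : ℕ} (hn : 0 < n) (M : Matrix (Fin m) (Fin m) L) :
    M.map (algebraMap (L : Type) 𝔸f) ∈ finLevelSubmonoid L m n ↔ IsCongruentOneMod n M := by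
  have hn' : (n : L) ≠ 0 := Nat.cast_ne_zero.mpr hn.ne'
  have hsub : M.map (algebraMap (L : Type) 𝔸f) - 1 = (M - 1).map (algebraMap (L : Type) 𝔸f) := by
    rw [Matrix.map_sub _ (map_sub (algebraMap (L : Type) 𝔸f)),
      Matrix.map_one (algebraMap (L : Type) 𝔸f) (map_zero _) (map_one _)]
  have hkey : ∀ i j, levelScalar L n * (M.map (algebraMap (L : Type) 𝔸f) - 1) i j =
      algebraMap (L : Type) 𝔸f ((n : L)⁻¹ * (M - 1) i j) := fun i j => by
    rw [hsub, Matrix.map_apply, levelScalar, map_mul]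
  rw [mem_finLevelSubmonoid_iff, isCongruentOneMod_iff hn]
  simp_rw [hkey, Matrix.map_apply, algebraMap_mem_integralFiniteAdeles_iff]
  constructor
  · exact fun h => h.2
  · intro h
    refine ⟨fun i j => ?_, h⟩
    obtain ⟨r, hr⟩ := h i j
    have hMij : M i j = (1 : Matrix (Fin m) (Fin m) L) i j + n * algebraMap (𝓞 L) L r := by
      rw [hr, ← mul_assoc, mul_inv_cancel₀ hn', one_mul, Matrix.sub_apply, add_sub_cancel]
    refine ⟨(if i = j then 1 else 0) + n * r, ?_⟩
    rw [hMij, Matrix.one_apply, map_add, map_mul, map_natCast]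
    split_ifs <;> simp


-- port_pkg: scope closed for this part
end Rational
end HodgeCM.PerL34.Godement
end
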